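import Literature.MathematicalPhysics.QuantumFieldTheory.BalabanImbrieJaffe1984to88.BIJ88Eq5145Remainder
import Literature.MathematicalPhysics.QuantumFieldTheory.BalabanImbrieJaffe1984to88.BIJ88EffectiveActionNoncentred308

/-!
# `BalabanImbrieJaffe1984to88.BIJ88Eq5145CornerNoncentred` — T. Bałaban, J. Imbrie, A. Jaffe, *Effective action and cluster properties of the
abelian Higgs model*, Commun. Math. Phys. **114** (1988) 257–315 [BalabanImbrieJaffe1988]: Sect. 5.14, p. 312 [PDF 56], **(5.14.5) ON THE §5.13
GAUSSIAN MODEL WITH (5.14.1)–(5.14.2) AT `t = 0` BY NAME AND NO CENTRING** (rows `C2.Eq5.14.5`, `C2.Eq5.14.1-5.14.2`): p25 g13's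
`BIJ88Eq5145CornerUrsell` discharges the per-region `hlogz` of `BIJ88Eq5145CornerModel.eq5145_zG` (*"−log z₁(Λ₁₂) = 𝒫̃_{k+1}(Λ₁₂) + ℛ_k(Λ₁₂)"*,
(5.14.2) p. 308) by p36's CENTRED `t = 0` theorems, so its `eq5145_zG_ursell` carries `h0 : E Φ_b = 0` and its `eq5145_zG_linear` /
`eq5145_zG_linear_Tsum_of_ineq5144` carry the mean-field condition `hcen : Φ_b((Δ_{1_{Λ₁₂′}}|_{Λ₁₂})⁻¹ℱ|_{Λ₁₂}) = 0` — displayed for the boundary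
source `ℱ ≠ 0` of p. 305 (*"Recall that we have a linear term in the measure, ⟨Φ,ℱ⟩"*).  Here the same three theorems are re-derived from this
generation's NON-CENTRED `t = 0` end (`BIJ88EffectiveActionNoncentred308`): **`h0` / `hcen` DELETED for every `ℱ`.**

statement-level skeleton of published theorems with citation tags; proofs where landed; nothing here is a claim about the Yang–Mills mass gap

PDF held: `paper:balaban1988-cmp114-bij-abelian-higgs-effective-action` (journal page = PDF page + 256); pp. 305, 308, 312 = PDF 49, 52, 56.

WHAT IS REPRODUCED (unit `lit-balaban-p36`, generation 12 of the Phase-2 proof seat p36, file 4; SKELETON rows **C2.Eq5.14.5** (member) and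
**C2.Eq5.14.1-5.14.2** (member) of `HOME/lit-balaban-r16/ROWS-C2-part2.md`, owner r16, heads untouched; HOME `run/shared/lean/pub/lit-balaban/`).
Theorems only (0 definitions, 0 `Prop` facts): **`eq5145_zG_ursell'`** — p25's `eq5145_zG_ursell` with `hJ` (joint Gaussian law) weakened to
Gaussian MARGINAL laws of the located slot fields and `h0` (centring) DELETED (positivity of the region's `z_t` is structural, the `t = 0` end is
`BIJ88EffectiveActionNoncentred308.effectiveAction_eq_pertP_add_remR_ursell_of_hasGaussianLaw`); **`eq5145_zG_linear'`** — p25's `eq5145_zG_linear`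
with `hcen` DELETED (LINEAR slot fields of the print, ANY source `ℱ`; displayed per region: `s₀`, `hrem`, `h311` only — what p25's
`eq5145_zG_linear_noSource` gave for `ℱ = 0`, now for every `ℱ`); **`eq5145_zG_linear_Tsum_of_ineq5144'`** — p25's `eq5145_zG_linear_Tsum_of_ineq5144`
with `hcen` DELETED (remainder as the display-3 connected-graph series over the region's virtual supports, modulo the leaf (5.14.4) `h5144`);
**`eq5145_zG_linear_remR_of_ineq5144'`** — p25's `BIJ88Eq5145Remainder.eq5145_zG_linear_remR_of_ineq5144` (p322790: `ℛ_k(Λ₁₂)` ITSELF in the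
exponent, no `W₆′` data) with `hcen` DELETED: displayed per region ONLY `s₀`, the leaf `h5144` and p. 311 `h311` — for EVERY source `ℱ` (what p25's
`…_noSource_…` gave for `ℱ = 0`).
HONEST SCOPE: exactly p25's (`BIJ88Eq5145CornerUrsell`): cube-local observables; the IBP structure of `z_F/z` not re-derived; (5.14.1) in its ruled
admissible reading; `hrem` (display 4 regrouping `Σ_X W₆′(X)`) and `h311` / `h5144` displayed per region; `(n̄+1)!` slip GAPS G-C2-p36-06.  Imports
`BIJ88Eq5145Remainder` (p25 g13; hence `BIJ88Eq5145CornerUrsell`) and `BIJ88EffectiveActionNoncentred308` (p36 g12); modifies nothing.  NOT summit progress; NOT continuum; NOT Clay.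
Cell `lit-balaban` Phase 2, seat p36 gen 12 (row owner r16, referee ref-5).
-/

noncomputable section

open Finset MeasureTheory ProbabilityTheory
open Literature.Probability.LatticeModels (ursellOf)
open Literature.MathematicalPhysics.QuantumFieldTheory.BalabanImbrieJaffe1984to88.BIJ88DirichletForms305 (interpForm)
open Literature.MathematicalPhysics.QuantumFieldTheory.BalabanImbrieJaffe1984to88.BIJ88PolymerRep5134 (g1 IsAdmissible corner)
open Literature.MathematicalPhysics.QuantumFieldTheory.BalabanImbrieJaffe1984to88.BIJ88PolymerRep5134Gauss (ext prec src expect zG)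
open Literature.MathematicalPhysics.QuantumFieldTheory.BalabanImbrieJaffe1984to88.BIJ88Resummation5141 (outer lam12)
open Literature.MathematicalPhysics.QuantumFieldTheory.BalabanImbrieJaffe1984to88.BIJ88Resummation5141Adm (lam12')
open Literature.MathematicalPhysics.QuantumFieldTheory.BalabanImbrieJaffe1984to88.BIJ88Expansion5143Gauss (fD)
open Literature.MathematicalPhysics.QuantumFieldTheory.BalabanImbrieJaffe1984to88.BIJ88SlotMoments308 (zt slotMoment)
open Literature.MathematicalPhysics.QuantumFieldTheory.BalabanImbrieJaffe1984to88.BIJ88SlotMomentsGauss308 (uD continuous_ext measurable_ext)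
open Literature.MathematicalPhysics.QuantumFieldTheory.BalabanImbrieJaffe1984to88.BIJ88EffectiveActionNoncentred308
  (effectiveAction_eq_pertP_add_remR_ursell_of_hasGaussianLaw effectiveAction_fieldLaw_eq_pertP_add_remR_Tsum_of_ineq5144')
open Literature.MathematicalPhysics.QuantumFieldTheory.BalabanImbrieJaffe1984to88.BIJ88Expansion5143 (g3 prime)
open Literature.MathematicalPhysics.QuantumFieldTheory.BalabanImbrieJaffe1984to88.BIJ88Expansion5143Ordered (polysOf cvsupp locv wv)
open Literature.MathematicalPhysics.QuantumFieldTheory.BalabanImbrieJaffe1984to88.BIJ88ConnectedGraphResummation (Tsum)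
open Literature.MathematicalPhysics.QuantumFieldTheory.BalabanImbrieJaffe1984to88.BIJ88Ineq5113Covering (cubeSys)
open Literature.MathematicalPhysics.QuantumFieldTheory.BalabanImbrieJaffe1984to88.BIJ88Sect5StatementsPart2 (Ineq5144)
open Literature.MathematicalPhysics.QuantumFieldTheory.BalabanImbrieJaffe1984to88.BIJ88Sect5Statements (CutoffProfile)
open Literature.MathematicalPhysics.QuantumFieldTheory.BalabanImbrieJaffe1984to88.BIJ88Sect5StatementsPart4 (remR pertP)
open Literature.MathematicalPhysics.QuantumFieldTheory.BalabanImbrieJaffe1984to88.BIJ88Eq5145CornerModel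
open Literature.MathematicalPhysics.QuantumFieldTheory.BalabanImbrieJaffe1984to88.BIJ88Eq5145CornerUrsell (hasGaussianLaw_slotFields_regionLaw
  cubeIn cubeIn_mem interpForm_abutting ztIn_eq_zG_located)
open Literature.MathematicalPhysics.QuantumFieldTheory.BalabanImbrieJaffe1984to88.BIJ88Eq5145Remainder (sum_add_ite_eq)

namespace Literature.MathematicalPhysics.QuantumFieldTheory.BalabanImbrieJaffe1984to88.BIJ88Eq5145CornerNoncentred

variable {α I : Type} [Fintype α] [DecidableEq α] [Fintype I] [DecidableEq I]
  (blk : α → I) (Δ : Matrix α α ℝ) (ℱ : α → ℝ)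
variable (adj : I → I → Prop) [DecidableRel adj]
variable (χ : CutoffProfile) {ι υ : Type*} [DecidableEq ι] [DecidableEq υ]
variable {p ek : ℝ} {B : Finset ι} {Φ : ι → (α → ℝ) → ℝ} {c : ι → ℝ} {Ys : Finset υ} {V : υ → (α → ℝ) → ℝ}
variable (cube : ↥B ⊕ ↥Ys → I) {L : Type*} (γ : L → ↥B ⊕ ↥Ys)

/-- **(5.14.5) ON THE MODEL WITH (5.14.1)–(5.14.2) AT `t = 0` BY NAME, FOR SLOT FIELDS WITH GAUSSIAN LAWS OF ANY MEANS**: p25's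
`BIJ88Eq5145CornerUrsell.eq5145_zG_ursell` with its joint-Gaussian hypothesis `hJ` weakened to Gaussian MARGINAL laws of the located slot fields
`Φ_b ∘ ext` under the law of `Λ₁₂` at `1_{Λ₁₂′}` (`hG`) and its centring `h0` DELETED: per region `pert := pertP(log z_t)`,
`rem := (n̄+1)·remR(t ↦ Σ_γ uᵀ_{γ,t})` FED BY NAME by `BIJ88EffectiveActionNoncentred308.effectiveAction_eq_pertP_add_remR_ursell_of_hasGaussianLaw`
(the region's `z_t > 0` on `(0,1]` is p25's `zG_fD_empty_pos`). Displayed per region: `hG`, a located slot `s₀`, `hrem` (`ℛ = Σ_X W₆′(X)`), `h311`;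
`χ ≥ 0`, `p > 1/2`, continuous cube-local fields vanishing at `0`, `c_b ≥ c₀ > 0`, measurable bounded cube-local terms, `0 < e_k < e^{−1}`, `n̄+1` labels.
[cite: BalabanImbrieJaffe1988, (5.14.5) p.312; (5.14.1)–(5.14.2) p.308] -/
theorem eq5145_zG_ursell' (hΔadj : ∀ x y, blk x ≠ blk y → ¬ adj (blk x) (blk y) → Δ x y = 0) (hΔ : Δ.PosDef)
    (hχ : ∀ x, 0 ≤ χ.χ₁ x) (hp : 1 / 2 < p) (hΦc : ∀ b ∈ B, Continuous (Φ b)) (hΦ0 : ∀ b ∈ B, Φ b 0 = 0) {c₀ : ℝ} (hc₀ : 0 < c₀)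
    (hcb : ∀ b ∈ B, c₀ ≤ c b) (hV : ∀ Y ∈ Ys, Measurable (V Y)) {KY : υ → ℝ} (hK : ∀ Y ∈ Ys, ∀ φ, |V Y φ| ≤ KY Y)
    (hek : 0 < ek) (hek1 : ek < Real.exp (-1))
    (hΦloc : ∀ b : B, ∀ φ ψ : α → ℝ, (∀ x, blk x = cube (Sum.inl b) → φ x = ψ x) → Φ b φ = Φ b ψ)
    (hVloc : ∀ Y : Ys, ∀ φ ψ : α → ℝ, (∀ x, blk x = cube (Sum.inr Y) → φ x = ψ x) → V Y φ = V Y ψ)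
    (F : I → (α → ℝ) → ℝ) (hFloc : ∀ i (φ ψ : α → ℝ), (∀ x, blk x = i → φ x = ψ x) → F i φ = F i ψ)
    {αL : Type*} [Fintype αL] [DecidableEq αL] {nbar : ℕ} (hα : Fintype.card αL = nbar + 1)
    (W Bl : Finset I) {Xt : Type*} (𝒳 : Finset Xt) (Vconst PL : ℝ) (W6p W6pp : Finset (Finset I) → Xt → ℝ)
    (s₀ : (ρ : Finset (Finset I)) → ↥(slotB B Ys cube (lam12 W ρ)) ⊕ ↥(slotY B Ys cube (lam12 W ρ)))
    (hG : ∀ ρ ∈ (outer W Bl).filter (IsAdmissible adj), ∀ b ∈ slotB B Ys cube (lam12 W ρ),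
      HasGaussianLaw (fun ω => Φ b (ext blk (lam12 W ρ) ω)) (regionLaw blk Δ ℱ (lam12 W ρ) (lam12' adj W ρ)))
    (hrem : ∀ ρ ∈ (outer W Bl).filter (IsAdmissible adj),
      (nbar + 1 : ℝ) * remR (fun t => ∑ γ' : αL → ↥(slotB B Ys cube (lam12 W ρ)) ⊕ ↥(slotY B Ys cube (lam12 W ρ)),
        ursellOf (fun K' => slotMoment χ p ek (slotB B Ys cube (lam12 W ρ)) (fun b ω => Φ b (ext blk (lam12 W ρ) ω))
          (fun b => c b) (slotY B Ys cube (lam12 W ρ)) (fun Y ω => V Y (ext blk (lam12 W ρ) ω))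
          (regionLaw blk Δ ℱ (lam12 W ρ) (lam12' adj W ρ)) t K' γ') univ) nbar = ∑ X ∈ 𝒳, W6p ρ X)
    (h311 : ∀ ρ ∈ (outer W Bl).filter (IsAdmissible adj),
      Vconst + pertP (fun t => Real.log (ztIn blk Δ ℱ χ p ek B Φ c Ys V cube (lam12 W ρ) (lam12' adj W ρ) t)) nbar =
        PL + ∑ X ∈ 𝒳, W6pp ρ X) :
    Real.exp (-Vconst) * expect blk Δ ℱ (fun i φ => fD (uD χ p ek B Φ c Ys V 1) cube γ ∅ i φ * F i φ) W (corner ℝ W) =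
      ∑ ρ ∈ (outer W Bl).filter (IsAdmissible adj),
        (∏ X ∈ ρ, g1 adj (zG blk Δ ℱ (fun i φ => fD (uD χ p ek B Φ c Ys V 1) cube γ ∅ i φ * F i φ)) X) *
          (zG blk Δ ℱ (fun i φ => fD (uD χ p ek B Φ c Ys V 1) cube γ ∅ i φ * F i φ) (lam12 W ρ) (lam12' adj W ρ) /
              zG blk Δ ℱ (fD (uD χ p ek B Φ c Ys V 1) cube γ ∅) (lam12 W ρ) (lam12' adj W ρ) *
            Real.exp (-PL - ∑ X ∈ 𝒳, (W6p ρ X + W6pp ρ X))) := by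
  refine eq5145_zG blk Δ ℱ adj χ cube γ hΔadj hΔ hχ (by linarith) hΦc hΦ0 hc₀ hcb hV hK hek hek1.le hΦloc hVloc F hFloc
    W Bl 𝒳 Vconst PL
    (fun ρ => pertP (fun t => Real.log (ztIn blk Δ ℱ χ p ek B Φ c Ys V cube (lam12 W ρ) (lam12' adj W ρ) t)) nbar)
    (fun ρ => (nbar + 1 : ℝ) * remR (fun t => ∑ γ' : αL → ↥(slotB B Ys cube (lam12 W ρ)) ⊕ ↥(slotY B Ys cube (lam12 W ρ)),
        ursellOf (fun K' => slotMoment χ p ek (slotB B Ys cube (lam12 W ρ)) (fun b ω => Φ b (ext blk (lam12 W ρ) ω))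
          (fun b => c b) (slotY B Ys cube (lam12 W ρ)) (fun Y ω => V Y (ext blk (lam12 W ρ) ω))
          (regionLaw blk Δ ℱ (lam12 W ρ) (lam12' adj W ρ)) t K' γ') univ) nbar)
    W6p W6pp (fun ρ hρ => ?_) hrem h311
  -- (5.14.1)–(5.14.2) at `t = 0` for the region's `z_t`, by name, NO centring
  haveI := isProbabilityMeasure_regionLaw blk Δ ℱ hΔ (lam12 W ρ) (lam12' adj W ρ)
  have hΦ' : ∀ b ∈ slotB B Ys cube (lam12 W ρ), Measurable fun ω : {x : α // blk x ∈ lam12 W ρ} → ℝ => Φ b (ext blk (lam12 W ρ) ω) :=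
    fun b _ => ((hΦc b b.2).comp (continuous_ext blk (lam12 W ρ))).measurable
  have hV' : ∀ Y ∈ slotY B Ys cube (lam12 W ρ), Measurable fun ω : {x : α // blk x ∈ lam12 W ρ} → ℝ => V Y (ext blk (lam12 W ρ) ω) :=
    fun Y _ => (hV Y Y.2).comp (measurable_ext blk (lam12 W ρ))
  have hzpos : ∀ t ∈ Set.Ioc (0 : ℝ) 1, 0 < ztIn blk Δ ℱ χ p ek B Φ c Ys V cube (lam12 W ρ) (lam12' adj W ρ) t := fun t ht => by
    rw [← zG_fD_empty_eq_ztIn blk Δ ℱ χ (p := p) (ek := ek) (B := B) (Φ := Φ) (c := c) (Ys := Ys) (V := V) cube γ t]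
    exact zG_fD_empty_pos blk Δ ℱ χ p ek B Φ c Ys V cube γ hχ (by linarith) hΔ hΦc hΦ0 hc₀ hcb hV hK hek ht.1
      (BIJ88ZtPositivity308.mul_le_exp_neg_one_of_Ioc hek hek1.le ht) _ _
  have h14 := (effectiveAction_eq_pertP_add_remR_ursell_of_hasGaussianLaw χ hp (regionLaw blk Δ ℱ (lam12 W ρ) (lam12' adj W ρ))
    (B := slotB B Ys cube (lam12 W ρ)) (Φ := fun b ω => Φ b (ext blk (lam12 W ρ) ω)) (c := fun b => c b)
    (Ys := slotY B Ys cube (lam12 W ρ)) (V := fun Y ω => V Y (ext blk (lam12 W ρ) ω)) (hG ρ hρ) hΦ' hc₀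
    (fun b _ => hcb b b.2) hV' (KY := fun Y => KY Y) (fun Y _ ω => hK Y Y.2 _) hek hek1 hzpos hα (s₀ ρ)).1
  rw [zG_fD_empty_eq_ztIn]
  exact h14

/-- **(5.14.5) ON THE MODEL FOR THE LINEAR SLOT FIELDS OF THE PRINT — NO MEAN-FIELD CONDITION**: p25's `BIJ88Eq5145CornerUrsell.eq5145_zG_linear`
with `hcen : Φ_b((Δ_{1_{Λ₁₂′}}|_{Λ₁₂})⁻¹ℱ|_{Λ₁₂}) = 0` DELETED, for EVERY source `ℱ` (p. 305: *"Recall that we have a linear term in the measure, ⟨Φ,ℱ⟩"*):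
(5.13.4), (5.14.1), (5.14.2) at `t = 0`, *"z_F = (z_F/z)·z"*, `z > 0` and the Gaussianity of the slot fields ALL by name / proved; displayed per region:
a located slot `s₀`, `hrem` (`ℛ = Σ_X W₆′(X)`), `h311` — the hypothesis list p25's `eq5145_zG_linear_noSource` had for `ℱ = 0`.
[cite: BalabanImbrieJaffe1988, (5.14.5) p.312; (5.14.1)–(5.14.2) p.308; p.305 (Sect. 5.13)] -/
theorem eq5145_zG_linear' (hΔadj : ∀ x y, blk x ≠ blk y → ¬ adj (blk x) (blk y) → Δ x y = 0) (hΔ : Δ.PosDef)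
    (hχ : ∀ x, 0 ≤ χ.χ₁ x) (hp : 1 / 2 < p) (hlin : ∀ b ∈ B, IsLinearMap ℝ (Φ b)) {c₀ : ℝ} (hc₀ : 0 < c₀)
    (hcb : ∀ b ∈ B, c₀ ≤ c b) (hV : ∀ Y ∈ Ys, Measurable (V Y)) {KY : υ → ℝ} (hK : ∀ Y ∈ Ys, ∀ φ, |V Y φ| ≤ KY Y)
    (hek : 0 < ek) (hek1 : ek < Real.exp (-1))
    (hΦloc : ∀ b : B, ∀ φ ψ : α → ℝ, (∀ x, blk x = cube (Sum.inl b) → φ x = ψ x) → Φ b φ = Φ b ψ)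
    (hVloc : ∀ Y : Ys, ∀ φ ψ : α → ℝ, (∀ x, blk x = cube (Sum.inr Y) → φ x = ψ x) → V Y φ = V Y ψ)
    (F : I → (α → ℝ) → ℝ) (hFloc : ∀ i (φ ψ : α → ℝ), (∀ x, blk x = i → φ x = ψ x) → F i φ = F i ψ)
    {αL : Type*} [Fintype αL] [DecidableEq αL] {nbar : ℕ} (hα : Fintype.card αL = nbar + 1)
    (W Bl : Finset I) {Xt : Type*} (𝒳 : Finset Xt) (Vconst PL : ℝ) (W6p W6pp : Finset (Finset I) → Xt → ℝ)
    (s₀ : (ρ : Finset (Finset I)) → ↥(slotB B Ys cube (lam12 W ρ)) ⊕ ↥(slotY B Ys cube (lam12 W ρ)))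
    (hrem : ∀ ρ ∈ (outer W Bl).filter (IsAdmissible adj),
      (nbar + 1 : ℝ) * remR (fun t => ∑ γ' : αL → ↥(slotB B Ys cube (lam12 W ρ)) ⊕ ↥(slotY B Ys cube (lam12 W ρ)),
        ursellOf (fun K' => slotMoment χ p ek (slotB B Ys cube (lam12 W ρ)) (fun b ω => Φ b (ext blk (lam12 W ρ) ω))
          (fun b => c b) (slotY B Ys cube (lam12 W ρ)) (fun Y ω => V Y (ext blk (lam12 W ρ) ω))
          (regionLaw blk Δ ℱ (lam12 W ρ) (lam12' adj W ρ)) t K' γ') univ) nbar = ∑ X ∈ 𝒳, W6p ρ X)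
    (h311 : ∀ ρ ∈ (outer W Bl).filter (IsAdmissible adj),
      Vconst + pertP (fun t => Real.log (ztIn blk Δ ℱ χ p ek B Φ c Ys V cube (lam12 W ρ) (lam12' adj W ρ) t)) nbar =
        PL + ∑ X ∈ 𝒳, W6pp ρ X) :
    Real.exp (-Vconst) * expect blk Δ ℱ (fun i φ => fD (uD χ p ek B Φ c Ys V 1) cube γ ∅ i φ * F i φ) W (corner ℝ W) =
      ∑ ρ ∈ (outer W Bl).filter (IsAdmissible adj),
        (∏ X ∈ ρ, g1 adj (zG blk Δ ℱ (fun i φ => fD (uD χ p ek B Φ c Ys V 1) cube γ ∅ i φ * F i φ)) X) *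
          (zG blk Δ ℱ (fun i φ => fD (uD χ p ek B Φ c Ys V 1) cube γ ∅ i φ * F i φ) (lam12 W ρ) (lam12' adj W ρ) /
              zG blk Δ ℱ (fD (uD χ p ek B Φ c Ys V 1) cube γ ∅) (lam12 W ρ) (lam12' adj W ρ) *
            Real.exp (-PL - ∑ X ∈ 𝒳, (W6p ρ X + W6pp ρ X))) :=
  eq5145_zG_ursell' blk Δ ℱ adj χ cube γ hΔadj hΔ hχ hp
    (fun b hb => LinearMap.continuous_of_finiteDimensional ((hlin b hb).mk' (Φ b)))
    (fun b hb => ((hlin b hb).mk' (Φ b)).map_zero) hc₀ hcb hV hK hek hek1 hΦloc hVloc F hFloc hα W Bl 𝒳 Vconst PL W6p W6pp s₀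
    (fun ρ _ b hb => (hasGaussianLaw_slotFields_regionLaw blk Δ ℱ cube hΔ hlin (lam12 W ρ) (lam12' adj W ρ)).eval ⟨b, hb⟩)
    hrem h311

/-- **(5.14.5) ON THE MODEL, LINEAR SLOT FIELDS, REMAINDER AS THE CONNECTED-GRAPH SERIES OF DISPLAY 3 MODULO THE LEAF (5.14.4) — NO MEAN-FIELD
CONDITION**: p25's `BIJ88Eq5145CornerUrsell.eq5145_zG_linear_Tsum_of_ineq5144` with `hcen` DELETED, for every `ℱ`: per region `Λ₁₂` at `1_{Λ₁₂′}`,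
`hlogz` DISCHARGED by `BIJ88EffectiveActionNoncentred308.effectiveAction_fieldLaw_eq_pertP_add_remR_Tsum_of_ineq5144'` for the located slot data
(`slotB`, `slotY`, `cubeIn`) and the resummed form `Δ_{1_{Λ₁₂′}}`; displayed per region: `s₀`, THE LEAF (5.14.4) for the prime-dropped activities of
every assignment at every `t ∈ (0,1]` (`h5144`, gen 5's regime), `hrem` (display 4: `(n̄+1)·remR(Σ_γ T) = Σ_X W₆′(X)`) and `h311`.
[cite: BalabanImbrieJaffe1988, (5.14.5) p.312; (5.14.2) p.308; p.310 displays 3–4; (5.14.4) p.309] -/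
theorem eq5145_zG_linear_Tsum_of_ineq5144' {nbr : I → Finset I} {D : ℕ} {θ β' : ℝ} (hR : ∀ x y, adj x y → adj y x)
    (hD : ∀ x, (nbr x).card ≤ D) (hnbr : ∀ x y, adj x y → y ∈ nbr x) (hθ0 : 0 < θ) (hθ1 : θ ≤ 1) (hβ : 0 ≤ β')
    (hsmall : 16 * ((D : ℝ) + 1) ^ 2 * (θ ^ (β' / 2) * Real.exp 2) ≤ 1)
    (hΔadj : ∀ x y, blk x ≠ blk y → ¬ adj (blk x) (blk y) → Δ x y = 0) (hΔ : Δ.PosDef)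
    (hχ : ∀ x, 0 ≤ χ.χ₁ x) (hp : 1 / 2 < p) (hlin : ∀ b ∈ B, IsLinearMap ℝ (Φ b)) {c₀ : ℝ} (hc₀ : 0 < c₀)
    (hcb : ∀ b ∈ B, c₀ ≤ c b) (hV : ∀ Y ∈ Ys, Measurable (V Y)) {KY : υ → ℝ} (hK : ∀ Y ∈ Ys, ∀ φ, |V Y φ| ≤ KY Y)
    (hek : 0 < ek) (hek1 : ek < Real.exp (-1))
    (hΦloc : ∀ b : B, ∀ φ ψ : α → ℝ, (∀ x, blk x = cube (Sum.inl b) → φ x = ψ x) → Φ b φ = Φ b ψ)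
    (hVloc : ∀ Y : Ys, ∀ φ ψ : α → ℝ, (∀ x, blk x = cube (Sum.inr Y) → φ x = ψ x) → V Y φ = V Y ψ)
    (F : I → (α → ℝ) → ℝ) (hFloc : ∀ i (φ ψ : α → ℝ), (∀ x, blk x = i → φ x = ψ x) → F i φ = F i ψ)
    {L' : Type} [Fintype L'] [DecidableEq L'] {nbar : ℕ} (hL : Fintype.card L' = nbar + 1)
    (W Bl : Finset I) {Xt : Type*} (𝒳 : Finset Xt) (Vconst PL : ℝ) (W6p W6pp : Finset (Finset I) → Xt → ℝ)
    (s₀ : (ρ : Finset (Finset I)) → ↥(slotB B Ys cube (lam12 W ρ)) ⊕ ↥(slotY B Ys cube (lam12 W ρ)))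
    (h5144 : ∀ ρ ∈ (outer W Bl).filter (IsAdmissible adj), ∀ t ∈ Set.Ioc (0 : ℝ) 1,
      ∀ γ' : L' → ↥(slotB B Ys cube (lam12 W ρ)) ⊕ ↥(slotY B Ys cube (lam12 W ρ)),
      Ineq5144 (cubeSys I) (Finset L')
        (prime (g3 adj fun H' => zG blk (interpForm blk Δ (corner ℝ (lam12' adj W ρ))) ℱ
          (fD (uD χ p ek (slotB B Ys cube (lam12 W ρ)) (fun b : ↥B => Φ b) (fun b : ↥B => c b) (slotY B Ys cube (lam12 W ρ))
            (fun Y : ↥Ys => V Y) t) (cubeIn cube (lam12 W ρ)) γ' H')))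
        Finset.card (fun H (X' : Finset I) => (X' \ H.image (cubeIn cube (lam12 W ρ) ∘ γ')).card) θ β')
    (hrem : ∀ ρ ∈ (outer W Bl).filter (IsAdmissible adj),
      (nbar + 1 : ℝ) * remR (fun t => ∑ γ' : L' → ↥(slotB B Ys cube (lam12 W ρ)) ⊕ ↥(slotY B Ys cube (lam12 W ρ)),
        Tsum ((polysOf (lam12 W ρ)).image (cvsupp adj (lam12 W ρ))) (locv (cubeIn cube (lam12 W ρ) ∘ γ'))
          (wv (prime (g3 adj fun H' => zG blk (interpForm blk Δ (corner ℝ (lam12' adj W ρ))) ℱ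
            (fD (uD χ p ek (slotB B Ys cube (lam12 W ρ)) (fun b : ↥B => Φ b) (fun b : ↥B => c b) (slotY B Ys cube (lam12 W ρ))
              (fun Y : ↥Ys => V Y) t) (cubeIn cube (lam12 W ρ)) γ' H')))) univ) nbar = ∑ X' ∈ 𝒳, W6p ρ X')
    (h311 : ∀ ρ ∈ (outer W Bl).filter (IsAdmissible adj),
      Vconst + pertP (fun t => Real.log (ztIn blk Δ ℱ χ p ek B Φ c Ys V cube (lam12 W ρ) (lam12' adj W ρ) t)) nbar =
        PL + ∑ X' ∈ 𝒳, W6pp ρ X') :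
    Real.exp (-Vconst) * expect blk Δ ℱ (fun i φ => fD (uD χ p ek B Φ c Ys V 1) cube γ ∅ i φ * F i φ) W (corner ℝ W) =
      ∑ ρ ∈ (outer W Bl).filter (IsAdmissible adj),
        (∏ X ∈ ρ, g1 adj (zG blk Δ ℱ (fun i φ => fD (uD χ p ek B Φ c Ys V 1) cube γ ∅ i φ * F i φ)) X) *
          (zG blk Δ ℱ (fun i φ => fD (uD χ p ek B Φ c Ys V 1) cube γ ∅ i φ * F i φ) (lam12 W ρ) (lam12' adj W ρ) /
              zG blk Δ ℱ (fD (uD χ p ek B Φ c Ys V 1) cube γ ∅) (lam12 W ρ) (lam12' adj W ρ) *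
            Real.exp (-PL - ∑ X' ∈ 𝒳, (W6p ρ X' + W6pp ρ X'))) := by
  refine eq5145_zG blk Δ ℱ adj χ cube γ hΔadj hΔ hχ (by linarith)
    (fun b hb => LinearMap.continuous_of_finiteDimensional ((hlin b hb).mk' (Φ b)))
    (fun b hb => ((hlin b hb).mk' (Φ b)).map_zero) hc₀ hcb hV hK hek hek1.le hΦloc hVloc F hFloc W Bl 𝒳 Vconst PL
    (fun ρ => pertP (fun t => Real.log (ztIn blk Δ ℱ χ p ek B Φ c Ys V cube (lam12 W ρ) (lam12' adj W ρ) t)) nbar)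
    (fun ρ => (nbar + 1 : ℝ) * remR (fun t => ∑ γ' : L' → ↥(slotB B Ys cube (lam12 W ρ)) ⊕ ↥(slotY B Ys cube (lam12 W ρ)),
        Tsum ((polysOf (lam12 W ρ)).image (cvsupp adj (lam12 W ρ))) (locv (cubeIn cube (lam12 W ρ) ∘ γ'))
          (wv (prime (g3 adj fun H' => zG blk (interpForm blk Δ (corner ℝ (lam12' adj W ρ))) ℱ
            (fD (uD χ p ek (slotB B Ys cube (lam12 W ρ)) (fun b : ↥B => Φ b) (fun b : ↥B => c b) (slotY B Ys cube (lam12 W ρ))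
              (fun Y : ↥Ys => V Y) t) (cubeIn cube (lam12 W ρ)) γ' H')))) univ) nbar)
    W6p W6pp (fun ρ hρ => ?_) hrem h311
  -- p36 g12's hcen-free F3 for the located slot data of the region `Λ₁₂ = lam12 W ρ` and the form `Δ_{1_{Λ₁₂′}}`
  have hPD := prec_interp_corner_posDef blk Δ hΔ (lam12 W ρ) (lam12' adj W ρ)
  have h14 := (effectiveAction_fieldLaw_eq_pertP_add_remR_Tsum_of_ineq5144' blk (interpForm blk Δ (corner ℝ (lam12' adj W ρ))) ℱ
    (lam12 W ρ) adj χ (B := slotB B Ys cube (lam12 W ρ)) (Φ := fun b : ↥B => Φ b) (c := fun b : ↥B => c b)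
    (Ys := slotY B Ys cube (lam12 W ρ)) (V := fun Y : ↥Ys => V Y) (cubeIn cube (lam12 W ρ)) hR hD hnbr hθ0 hθ1 hβ hsmall hχ hp
    (interpForm_abutting blk Δ adj hΔadj (lam12' adj W ρ)) hPD (cubeIn_mem cube (lam12 W ρ)) (fun b φ ψ h => hΦloc b.1 φ ψ h)
    (fun Y φ ψ h => hVloc Y.1 φ ψ h) (fun b _ => hlin b b.2) hc₀ (fun b _ => hcb b b.2) (fun Y _ => hV Y Y.2)
    (KY := fun Y => KY Y) (fun Y _ φ => hK Y Y.2 φ) hek hek1 hL (s₀ ρ) (fun _ => s₀ ρ) (h5144 ρ hρ)).1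
  have hbr : ∀ t, ztIn blk Δ ℱ χ p ek B Φ c Ys V cube (lam12 W ρ) (lam12' adj W ρ) t = _ :=
    fun t => ztIn_eq_zG_located blk Δ ℱ χ cube (lam12 W ρ) (lam12' adj W ρ) (fun _ : L' => s₀ ρ) t
  rw [zG_fD_empty_eq_ztIn]
  simp only [hbr]
  exact h14

/-- **(5.14.5) ON THE MODEL, LINEAR SLOT FIELDS, WITH `ℛ_k(Λ₁₂)` ITSELF IN THE EXPONENT, MODULO THE LEAF — NO MEAN-FIELD CONDITION**: p25's
`BIJ88Eq5145Remainder.eq5145_zG_linear_remR_of_ineq5144` (`exp(−𝒫^L − Σ_X W₆″(X) − ℛ_k(Λ₁₂))`, `ℛ_k(Λ₁₂) := (n̄+1)·remR(t ↦ Σ_γ T_{γ,t})`, display 4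
read as the definition of the `W₆′` sum) with `hcen` DELETED, for every `ℱ`: displayed per region ONLY a located slot `s₀`, the leaf (5.14.4) `h5144`
and p. 311 `h311` (`𝒳` any index set with a member `X₀`). [cite: BalabanImbrieJaffe1988, (5.14.5) p.312; (5.14.2) p.308; p.310 displays 3–4; (5.14.4) p.309] -/
theorem eq5145_zG_linear_remR_of_ineq5144' {nbr : I → Finset I} {D : ℕ} {θ β' : ℝ} (hR : ∀ x y, adj x y → adj y x)
    (hD : ∀ x, (nbr x).card ≤ D) (hnbr : ∀ x y, adj x y → y ∈ nbr x) (hθ0 : 0 < θ) (hθ1 : θ ≤ 1) (hβ : 0 ≤ β')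
    (hsmall : 16 * ((D : ℝ) + 1) ^ 2 * (θ ^ (β' / 2) * Real.exp 2) ≤ 1)
    (hΔadj : ∀ x y, blk x ≠ blk y → ¬ adj (blk x) (blk y) → Δ x y = 0) (hΔ : Δ.PosDef)
    (hχ : ∀ x, 0 ≤ χ.χ₁ x) (hp : 1 / 2 < p) (hlin : ∀ b ∈ B, IsLinearMap ℝ (Φ b)) {c₀ : ℝ} (hc₀ : 0 < c₀)
    (hcb : ∀ b ∈ B, c₀ ≤ c b) (hV : ∀ Y ∈ Ys, Measurable (V Y)) {KY : υ → ℝ} (hK : ∀ Y ∈ Ys, ∀ φ, |V Y φ| ≤ KY Y)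
    (hek : 0 < ek) (hek1 : ek < Real.exp (-1))
    (hΦloc : ∀ b : B, ∀ φ ψ : α → ℝ, (∀ x, blk x = cube (Sum.inl b) → φ x = ψ x) → Φ b φ = Φ b ψ)
    (hVloc : ∀ Y : Ys, ∀ φ ψ : α → ℝ, (∀ x, blk x = cube (Sum.inr Y) → φ x = ψ x) → V Y φ = V Y ψ)
    (F : I → (α → ℝ) → ℝ) (hFloc : ∀ i (φ ψ : α → ℝ), (∀ x, blk x = i → φ x = ψ x) → F i φ = F i ψ)
    {L' : Type} [Fintype L'] [DecidableEq L'] {nbar : ℕ} (hL : Fintype.card L' = nbar + 1)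
    (W Bl : Finset I) {Xt : Type*} [DecidableEq Xt] (𝒳 : Finset Xt) {X₀ : Xt} (hX₀ : X₀ ∈ 𝒳) (Vconst PL : ℝ)
    (W6pp : Finset (Finset I) → Xt → ℝ)
    (s₀ : (ρ : Finset (Finset I)) → ↥(slotB B Ys cube (lam12 W ρ)) ⊕ ↥(slotY B Ys cube (lam12 W ρ)))
    (h5144 : ∀ ρ ∈ (outer W Bl).filter (IsAdmissible adj), ∀ t ∈ Set.Ioc (0 : ℝ) 1,
      ∀ γ' : L' → ↥(slotB B Ys cube (lam12 W ρ)) ⊕ ↥(slotY B Ys cube (lam12 W ρ)),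
      Ineq5144 (cubeSys I) (Finset L')
        (prime (g3 adj fun H' => zG blk (interpForm blk Δ (corner ℝ (lam12' adj W ρ))) ℱ
          (fD (uD χ p ek (slotB B Ys cube (lam12 W ρ)) (fun b : ↥B => Φ b) (fun b : ↥B => c b) (slotY B Ys cube (lam12 W ρ))
            (fun Y : ↥Ys => V Y) t) (cubeIn cube (lam12 W ρ)) γ' H')))
        Finset.card (fun H (X' : Finset I) => (X' \ H.image (cubeIn cube (lam12 W ρ) ∘ γ')).card) θ β')
    (h311 : ∀ ρ ∈ (outer W Bl).filter (IsAdmissible adj),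
      Vconst + pertP (fun t => Real.log (ztIn blk Δ ℱ χ p ek B Φ c Ys V cube (lam12 W ρ) (lam12' adj W ρ) t)) nbar =
        PL + ∑ X' ∈ 𝒳, W6pp ρ X') :
    Real.exp (-Vconst) * expect blk Δ ℱ (fun i φ => fD (uD χ p ek B Φ c Ys V 1) cube γ ∅ i φ * F i φ) W (corner ℝ W) =
      ∑ ρ ∈ (outer W Bl).filter (IsAdmissible adj),
        (∏ X ∈ ρ, g1 adj (zG blk Δ ℱ (fun i φ => fD (uD χ p ek B Φ c Ys V 1) cube γ ∅ i φ * F i φ)) X) *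
          (zG blk Δ ℱ (fun i φ => fD (uD χ p ek B Φ c Ys V 1) cube γ ∅ i φ * F i φ) (lam12 W ρ) (lam12' adj W ρ) /
              zG blk Δ ℱ (fD (uD χ p ek B Φ c Ys V 1) cube γ ∅) (lam12 W ρ) (lam12' adj W ρ) *
            Real.exp (-PL - ∑ X' ∈ 𝒳, W6pp ρ X' -
              (nbar + 1 : ℝ) * remR (fun t => ∑ γ' : L' → ↥(slotB B Ys cube (lam12 W ρ)) ⊕ ↥(slotY B Ys cube (lam12 W ρ)),
                Tsum ((polysOf (lam12 W ρ)).image (cvsupp adj (lam12 W ρ))) (locv (cubeIn cube (lam12 W ρ) ∘ γ'))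
                  (wv (prime (g3 adj fun H' => zG blk (interpForm blk Δ (corner ℝ (lam12' adj W ρ))) ℱ
                    (fD (uD χ p ek (slotB B Ys cube (lam12 W ρ)) (fun b : ↥B => Φ b) (fun b : ↥B => c b)
                      (slotY B Ys cube (lam12 W ρ)) (fun Y : ↥Ys => V Y) t) (cubeIn cube (lam12 W ρ)) γ' H')))) univ) nbar)) := by
  have h := eq5145_zG_linear_Tsum_of_ineq5144' blk Δ ℱ adj χ cube γ hR hD hnbr hθ0 hθ1 hβ hsmall hΔadj hΔ hχ hp hlin hc₀ hcb hV hK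
    hek hek1 hΦloc hVloc F hFloc hL W Bl 𝒳 Vconst PL
    (fun ρ X' => if X' = X₀ then (nbar + 1 : ℝ) * remR (fun t => ∑ γ' : L' → ↥(slotB B Ys cube (lam12 W ρ)) ⊕ ↥(slotY B Ys cube (lam12 W ρ)),
        Tsum ((polysOf (lam12 W ρ)).image (cvsupp adj (lam12 W ρ))) (locv (cubeIn cube (lam12 W ρ) ∘ γ'))
          (wv (prime (g3 adj fun H' => zG blk (interpForm blk Δ (corner ℝ (lam12' adj W ρ))) ℱ
            (fD (uD χ p ek (slotB B Ys cube (lam12 W ρ)) (fun b : ↥B => Φ b) (fun b : ↥B => c b)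
              (slotY B Ys cube (lam12 W ρ)) (fun Y : ↥Ys => V Y) t) (cubeIn cube (lam12 W ρ)) γ' H')))) univ) nbar else 0)
    W6pp s₀ h5144 (fun ρ _ => by rw [sum_ite_eq' 𝒳 X₀, if_pos hX₀]) h311
  simp only [sum_add_ite_eq 𝒳 hX₀] at h
  rw [h]
  refine sum_congr rfl fun ρ _ => ?_
  congr 2
  ring_nf

end Literature.MathematicalPhysics.QuantumFieldTheory.BalabanImbrieJaffe1984to88.BIJ88Eq5145CornerNoncentred

end
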